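import Mathlib.Analysis.CStarAlgebra.Matrix
import Mathlib.Analysis.CStarAlgebra.ContinuousLinearMap
import Mathlib.Algebra.Star.UnitaryStarAlgAut
import Mathlib.Algebra.Star.StarProjection
import Mathlib.Analysis.SpecialFunctions.ExpDeriv
import Mathlib.Analysis.Calculus.Deriv.Mul
import Mathlib.Analysis.Calculus.Deriv.Star
import Mathlib.Analysis.Complex.Trigonometric
import Literature.Analysis.FunctionSpaces.KMSStates
import HarnessLib

/-!
# The un-ordered ground-state bridge is false: a counterexample on `B(ℂ²)`

The named fact `Literature.MathematicalPhysics.QuantumLattice.State.isGroundState_iff_isKMSGroundState`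
(`Literature/Analysis/FunctionSpaces/KMSStates.lean`, Bratteli–Robinson II Prop. 5.3.19) was
declared under `variable [PartialOrder A]` only, i.e. for an ARBITRARY partial order on the
C⋆-algebra `A`, so that `State A` (monotone linear `ω : A → ℂ` with `ω 1 = 1`) need not consist
of positive functionals. This file proves, sorry-free, that the fact is false in that
generality (`not_isGroundState_iff_isKMSGroundState`), which is why the corrected fact
`Literature.MathematicalPhysics.QuantumLattice.State.isGroundState_iff_isKMSGroundState_of_starOrderedRing` carries `[StarOrderedRing A]`.
Since the verdict clean-up of 2026-08-15 the refuted record is `@[deprecated]` in `KMSStates.lean`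
(kept verbatim because `not_isGroundState_iff_isKMSGroundState` names it); that theorem is the
one declaration here exempted from `linter.deprecated`.

The counterexample (`namespace Literature.KMSGroundStateCounterexample`):
* abstract part, any C⋆-algebra `A` and any star projection `P` (`P² = P = P⋆`): the unitaries
  `projRotation P c = c • P + (1 - P)` (`|c| = 1`), the inner dynamics
  `projDynamics P hP t = Ad (projRotation P e^{it})` (a norm-continuous automorphism group,
  `isAutomorphismGroup_projDynamics`, with `d/dt|₀ τ_t(a) = i (P a - a P)`,
  `hasDerivAt_projDynamics`); for ANY `[PartialOrder A]` and any `ω : State A` killing the left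
  ideal `A P` (`ω (x * P) = 0`), the analytic (`β = +∞` KMS) condition holds
  (`isKMSGroundState_projDynamics`: `ω(a τ_t(b)) = c₀ + c₁ e^{it}` extends by `c₀ + c₁ e^{iz}`,
  bounded on `Im z ≥ 0`), while the generator condition forces `0 ≤ ω(a⋆ P a)` for all `a`
  (`nonneg_of_isGroundState_projDynamics`);
* concrete part: `DiscreteB2 = (EuclideanSpace ℂ (Fin 2) →L[ℂ] EuclideanSpace ℂ (Fin 2))`, a type
  synonym carrying Mathlib's C⋆-algebra structure and the DISCRETE order `x ≤ y ↔ x = y`;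
  `P = E₀₀`, `ω(x) = x₁₁ + x₀₁` (`badState`, linear, normalised, trivially monotone, not
  positive) and `a = E₀₁ + i E₀₀` give `ω(a⋆ P a) = 1 - i ≱ 0`.
Hence `badState` is an analytic ground state but not a ground state in the generator form, and
`State.isGroundState_iff_isKMSGroundState` fails for `A = DiscreteB2`.

Sources: O. Bratteli, D. W. Robinson, *Operator Algebras and Quantum Statistical Mechanics II*
(2nd ed., Springer 1997), Def. 5.3.18, Prop. 5.3.19 (states are positive there); S. Sakai,
*Operator Algebras in Dynamical Systems* (CUP 1991), Def. 4.2.1. The counterexample itself is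
elementary linear algebra. [folklore]
-/

noncomputable section

open Complex
open scoped ComplexOrder ComplexConjugate

namespace Literature.Analysis.FunctionSpaces

namespace KMSGroundStateCounterexample

/-! ### Abstract part: inner dynamics generated by a projection -/

section Abstract

variable {A : Type*} [CStarAlgebra A]

/-- The element `c • P + (1 - P)`; for a star projection `P` and `|c| = 1` this is the unitary
`e^{iθP}` (`c = e^{iθ}`). [folklore] -/
def projRotation (P : A) (c : ℂ) : A :=
  c • P + (1 - P)

/-- `projRotation P 1 = 1`. [folklore] -/
@[simp]
theorem projRotation_one (P : A) : projRotation P 1 = 1 := by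
  simp [projRotation]

/-- Sandwich formula: `(cP + Q) b (dP + Q) = cd PbP + c PbQ + d QbP + QbQ`, `Q = 1 - P`, for an
idempotent `P`. [folklore] -/
theorem projRotation_mul_mul_projRotation {P : A} (hP : IsIdempotentElem P) (b : A) (c d : ℂ) :
    projRotation P c * b * projRotation P d =
      (c * d) • (P * b * P) + c • (P * b * (1 - P)) + d • ((1 - P) * b * P) +
        (1 - P) * b * (1 - P) := by
  have hPP : P * P = P := hP.eq
  simp only [projRotation, add_mul, mul_add, smul_mul_assoc, mul_smul_comm, mul_assoc]
  module

/-- Group law: `projRotation P c * projRotation P d = projRotation P (c d)` for an idempotent `P`.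
[folklore] -/
theorem projRotation_mul {P : A} (hP : IsIdempotentElem P) (c d : ℂ) :
    projRotation P c * projRotation P d = projRotation P (c * d) := by
  have h := projRotation_mul_mul_projRotation hP 1 c d
  have hPP : P * P = P := hP.eq
  simp only [mul_one] at h
  rw [h]
  simp only [projRotation, mul_sub, sub_mul, mul_one, one_mul, hPP, smul_sub]
  module

/-- `(projRotation P c)⋆ = projRotation P c̄` for a self-adjoint `P`. [folklore] -/
theorem star_projRotation {P : A} (hP : IsSelfAdjoint P) (c : ℂ) :
    star (projRotation P c) = projRotation P (conj c) := by
  simp [projRotation, star_smul, hP.star_eq, star_sub]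

/-- `conj (e^{it}) · e^{it} = 1` for real `t`. [folklore] -/
theorem conj_exp_I_mul_mul_self (t : ℝ) : conj (cexp (I * t)) * cexp (I * t) = 1 := by
  rw [← exp_conj, ← Complex.exp_add]
  simp [Complex.conj_ofReal]

/-- `projRotation P c` is unitary for a star projection `P` and `c̄ c = 1`. [folklore] -/
theorem projRotation_mem_unitary {P : A} (hP : IsStarProjection P) {c : ℂ} (hc : conj c * c = 1) :
    projRotation P c ∈ unitary A := by
  have hc' : c * conj c = 1 := by rw [mul_comm]; exact hc
  rw [Unitary.mem_iff, star_projRotation hP.isSelfAdjoint, projRotation_mul hP.isIdempotentElem,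
    projRotation_mul hP.isIdempotentElem, hc, hc', projRotation_one]
  exact ⟨rfl, rfl⟩

/-- The unitary `e^{itP} = e^{it} P + (1 - P)` as an element of `unitary A`. [folklore] -/
def projUnitary (P : A) (hP : IsStarProjection P) (t : ℝ) : unitary A :=
  ⟨projRotation P (cexp (I * t)), projRotation_mem_unitary hP (conj_exp_I_mul_mul_self t)⟩

/-- Coercion of `projUnitary`. [folklore] -/
@[simp]
theorem coe_projUnitary (P : A) (hP : IsStarProjection P) (t : ℝ) :
    (projUnitary P hP t : A) = projRotation P (cexp (I * t)) :=
  rfl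

/-- `projUnitary P hP 0 = 1`. [folklore] -/
theorem projUnitary_zero (P : A) (hP : IsStarProjection P) : projUnitary P hP 0 = 1 :=
  Subtype.ext (by simp)

/-- `projUnitary P hP (s + t) = projUnitary P hP s * projUnitary P hP t`. [folklore] -/
theorem projUnitary_add (P : A) (hP : IsStarProjection P) (s t : ℝ) :
    projUnitary P hP (s + t) = projUnitary P hP s * projUnitary P hP t := by
  refine Subtype.ext ?_
  simp only [coe_projUnitary, Submonoid.coe_mul, projRotation_mul hP.isIdempotentElem,
    ← Complex.exp_add]
  congr 1
  push_cast
  ring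

/-- The **inner dynamics generated by the projection `P`**: `τ_t(x) = e^{itP} x e^{-itP}`
(`Unitary.conjStarAlgAut` of `projUnitary`), i.e. the dynamics of the Hamiltonian `H = P`.
[folklore] -/
def projDynamics (P : A) (hP : IsStarProjection P) (t : ℝ) : A ≃⋆ₐ[ℂ] A :=
  Unitary.conjStarAlgAut ℂ A (projUnitary P hP t)

/-- Explicit formula `τ_t(x) = u_t x u_t⋆`, `u_t = e^{it} P + (1 - P)`. [folklore] -/
theorem projDynamics_apply (P : A) (hP : IsStarProjection P) (t : ℝ) (x : A) :
    projDynamics P hP t x =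
      projRotation P (cexp (I * t)) * x * projRotation P (conj (cexp (I * t))) := by
  simp [projDynamics, Unitary.conjStarAlgAut_apply, star_projRotation hP.isSelfAdjoint]

/-- `projDynamics P hP` is a strongly (indeed norm-) continuous one-parameter group of
⋆-automorphisms (`IsAutomorphismGroup`, orientation `τ (s + t) = (τ t).trans (τ s)`). [folklore] -/
theorem isAutomorphismGroup_projDynamics (P : A) (hP : IsStarProjection P) :
    Literature.MathematicalPhysics.QuantumLattice.IsAutomorphismGroup (projDynamics P hP) := by
  refine ⟨?_, fun s t => ?_, fun a => ?_⟩
  · rw [projDynamics, projUnitary_zero, map_one]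
    rfl
  · rw [projDynamics, projDynamics, projDynamics, Unitary.conjStarAlgAut_trans_conjStarAlgAut,
      projUnitary_add]
  · have hu : Continuous fun t : ℝ => projRotation P (cexp (I * t)) := by
      unfold projRotation
      fun_prop
    have hv : Continuous fun t : ℝ => projRotation P (conj (cexp (I * t))) := by
      simpa only [star_projRotation hP.isSelfAdjoint] using hu.star
    simp only [projDynamics_apply]
    exact (hu.mul continuous_const).mul hv

/-- The generator on every element: `d/dt|₀ τ_t(a) = i (P a - a P)`. [folklore] -/
theorem hasDerivAt_projDynamics (P : A) (hP : IsStarProjection P) (a : A) :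
    HasDerivAt (fun t : ℝ => projDynamics P hP t a) (I • (P * a - a * P)) 0 := by
  have hPP : P * P = P := hP.isIdempotentElem.eq
  -- the scalar function `t ↦ e^{it}` and its conjugate
  have he : HasDerivAt (fun t : ℝ => cexp (I * t)) I 0 := by
    have h1 : HasDerivAt (fun w : ℂ => cexp (I * w)) (cexp (I * ((0 : ℝ) : ℂ)) * (I * 1))
        ((0 : ℝ) : ℂ) := ((hasDerivAt_id _).const_mul I).cexp
    simpa using h1.comp_ofReal
  have hes : HasDerivAt (fun t : ℝ => conj (cexp (I * t))) (-I) 0 := by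
    have h := he.star
    simp only [Complex.star_def, Complex.conj_I] at h
    exact h
  have hu : HasDerivAt (fun t : ℝ => projRotation P (cexp (I * t))) (I • P) 0 := by
    simpa [projRotation] using (he.smul_const P).add_const (1 - P)
  have hv : HasDerivAt (fun t : ℝ => projRotation P (conj (cexp (I * t)))) ((-I) • P) 0 := by
    simpa [projRotation] using (hes.smul_const P).add_const (1 - P)
  have hprod := (hu.mul_const a).mul hv
  have hfun : (fun t : ℝ => projDynamics P hP t a) = fun t : ℝ =>
      projRotation P (cexp (I * t)) * a * projRotation P (conj (cexp (I * t))) :=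
    funext fun t => projDynamics_apply P hP t a
  rw [hfun]
  refine hprod.congr_deriv ?_
  simp (failIfUnchanged := false) only [ofReal_zero, mul_zero, Complex.exp_zero, map_one,
    projRotation_one, mul_one, one_mul, smul_mul_assoc, mul_smul_comm, neg_smul, mul_neg, smul_sub]
  module

variable [PartialOrder A]

/-- If `ω` is a ground state (generator form) for the inner dynamics of `P`, then
`0 ≤ ω(a⋆ P a) - ω(a⋆ a P)` for every `a` (this is `-i ω(a⋆ δ(a))`). Valid for any partial
order on `A`. [folklore] -/
theorem sub_nonneg_of_isGroundState_projDynamics {P : A} (hP : IsStarProjection P) {ω : Literature.MathematicalPhysics.QuantumLattice.State A}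
    (hω : ω.IsGroundState (projDynamics P hP)) (a : A) :
    0 ≤ ω (star a * P * a) - ω (star a * a * P) := by
  have h := hω a _ (hasDerivAt_projDynamics P hP a)
  have hI : -I * ω (star a * (I • (P * a - a * P))) = ω (star a * P * a) - ω (star a * a * P) := by
    rw [mul_smul_comm, map_smul, smul_eq_mul, ← mul_assoc]
    simp [mul_sub, map_sub, mul_assoc]
  rwa [hI] at h

/-- If moreover `ω` kills the left ideal `A P` (`ω (x P) = 0`), the generator condition forces
`0 ≤ ω(a⋆ P a)` for all `a`. [folklore] -/
theorem nonneg_of_isGroundState_projDynamics {P : A} (hP : IsStarProjection P) {ω : Literature.MathematicalPhysics.QuantumLattice.State A}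
    (hω0 : ∀ x : A, ω (x * P) = 0) (hω : ω.IsGroundState (projDynamics P hP)) (a : A) :
    0 ≤ ω (star a * P * a) := by
  simpa [hω0] using sub_nonneg_of_isGroundState_projDynamics hP hω a

/-- **Analytic form for free.** For ANY partial order on `A` and any `ω : State A` killing the
left ideal `A P`, `ω` is a ground state in the analytic (`β = +∞` KMS) form for the inner
dynamics of `P`: `ω(a τ_t(b)) = ω(a(PbP + QbQ)) + e^{it} ω(a P b Q)` (`Q = 1 - P`; the
`e^{-it}`-term `ω((aQb)P)` vanishes), and `z ↦ c₀ + c₁ e^{iz}` is entire and bounded by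
`|c₀| + |c₁|` on `Im z ≥ 0`. [folklore] -/
theorem isKMSGroundState_projDynamics {P : A} (hP : IsStarProjection P) {ω : Literature.MathematicalPhysics.QuantumLattice.State A}
    (hω0 : ∀ x : A, ω (x * P) = 0) : ω.IsKMSGroundState (projDynamics P hP) := by
  intro a b
  set c₀ : ℂ := ω (a * (P * b * P)) + ω (a * ((1 - P) * b * (1 - P))) with hc₀
  set c₁ : ℂ := ω (a * (P * b * (1 - P))) with hc₁
  refine ⟨fun z => c₀ + cexp (I * z) * c₁, ?_, ?_, ⟨‖c₀‖ + ‖c₁‖, fun z hz => ?_⟩, fun t => ?_⟩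
  · exact Continuous.continuousOn (by fun_prop)
  · exact Differentiable.differentiableOn (by fun_prop)
  · have hexp : ‖cexp (I * z)‖ ≤ 1 := by
      rw [Complex.norm_exp]
      have : (I * z).re = -z.im := by simp
      rw [this, Real.exp_le_one_iff]
      simpa using hz
    calc ‖c₀ + cexp (I * z) * c₁‖ ≤ ‖c₀‖ + ‖cexp (I * z) * c₁‖ := norm_add_le _ _
      _ = ‖c₀‖ + ‖cexp (I * z)‖ * ‖c₁‖ := by rw [norm_mul]
      _ ≤ ‖c₀‖ + 1 * ‖c₁‖ := by gcongr
      _ = ‖c₀‖ + ‖c₁‖ := by rw [one_mul]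
  · have hkill : ω (a * ((1 - P) * b * P)) = 0 := by
      have : a * ((1 - P) * b * P) = a * ((1 - P) * b) * P := by simp only [mul_assoc]
      rw [this, hω0]
    rw [projDynamics_apply, projRotation_mul_mul_projRotation hP.isIdempotentElem,
      mul_comm (cexp (I * t)) (conj (cexp (I * t))), conj_exp_I_mul_mul_self, one_smul]
    simp only [mul_add, map_add, mul_smul_comm, map_smul, smul_eq_mul, hkill, mul_zero, add_zero]
    ring

end Abstract

/-! ### Concrete part: `B(ℂ²)` with the discrete order -/

/-- The C⋆-algebra `B(ℂ²)` of bounded operators on `EuclideanSpace ℂ (Fin 2)`, as a type synonym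
that will carry the DISCRETE partial order (instead of Mathlib's Löwner order). [folklore] -/
def DiscreteB2 : Type :=
  EuclideanSpace ℂ (Fin 2) →L[ℂ] EuclideanSpace ℂ (Fin 2)

/-- Mathlib's C⋆-algebra structure on `B(ℂ²)`, transported to the synonym. [folklore] -/
instance DiscreteB2.instCStarAlgebra : CStarAlgebra DiscreteB2 :=
  inferInstanceAs (CStarAlgebra (EuclideanSpace ℂ (Fin 2) →L[ℂ] EuclideanSpace ℂ (Fin 2)))

/-- The DISCRETE order `x ≤ y ↔ x = y` on `B(ℂ²)`: every map out of it is monotone, so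
`State DiscreteB2` is the set of ALL linear functionals `ω` with `ω 1 = 1`. [folklore] -/
instance DiscreteB2.instPartialOrder : PartialOrder DiscreteB2 where
  le x y := x = y
  le_refl _ := rfl
  le_trans _ _ _ h₁ h₂ := h₁.trans h₂
  le_antisymm _ _ h _ := h

/-- Matrices as elements of `DiscreteB2` (Mathlib's `Matrix.toEuclideanCLM`, a ⋆-algebra
equivalence). [folklore] -/
def ofMatrix : Matrix (Fin 2) (Fin 2) ℂ ≃⋆ₐ[ℂ] DiscreteB2 :=
  Matrix.toEuclideanCLM (n := Fin 2) (𝕜 := ℂ)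

/-- The rank-one projection `P = E₀₀`. [folklore] -/
def proj : DiscreteB2 :=
  ofMatrix !![1, 0; 0, 0]

/-- The test element `a = E₀₁ + i E₀₀`. [folklore] -/
def badElement : DiscreteB2 :=
  ofMatrix !![I, 1; 0, 0]

/-- `P = E₀₀` is a star projection. [folklore] -/
theorem isStarProjection_proj : IsStarProjection proj := by
  refine ⟨?_, ?_⟩
  · change proj * proj = proj
    rw [proj, ← map_mul]
    refine congrArg ofMatrix ?_
    ext i j
    fin_cases i <;> fin_cases j <;> simp [Matrix.mul_apply, Fin.sum_univ_two]
  · change star proj = proj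
    rw [proj, ← map_star]
    refine congrArg ofMatrix ?_
    ext i j
    fin_cases i <;> fin_cases j <;> simp

/-- The functional `ω(x) = x₁₁ + x₀₁` as a linear map. [folklore] -/
def badFunctional : DiscreteB2 →ₗ[ℂ] ℂ where
  toFun x := ofMatrix.symm x 1 1 + ofMatrix.symm x 0 1
  map_add' x y := by
    simp only [map_add, Matrix.add_apply]
    ring
  map_smul' r x := by
    simp only [map_smul, Matrix.smul_apply, smul_eq_mul, RingHom.id_apply]
    ring

/-- `badFunctional (ofMatrix M) = M 1 1 + M 0 1`. [folklore] -/
@[simp]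
theorem badFunctional_ofMatrix (M : Matrix (Fin 2) (Fin 2) ℂ) :
    badFunctional (ofMatrix M) = M 1 1 + M 0 1 := by
  simp [badFunctional]

/-- The **bad state** `ω(x) = x₁₁ + x₀₁` on `DiscreteB2`: linear, `ω 1 = 1`, monotone for the
discrete order — but not positive (`ω(a⋆ P a) = 1 - i` for `a = badElement`). [folklore] -/
def badState : Literature.MathematicalPhysics.QuantumLattice.State DiscreteB2 where
  toPositiveLinearMap :=
    { toLinearMap := badFunctional
      monotone' := fun x y (h : x = y) => by rw [h] }
  map_one' := by
    change badFunctional 1 = 1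
    rw [← map_one ofMatrix, badFunctional_ofMatrix]
    simp

/-- `badState x = (ofMatrix⁻¹ x)₁₁ + (ofMatrix⁻¹ x)₀₁`. [folklore] -/
theorem badState_apply (x : DiscreteB2) :
    badState x = ofMatrix.symm x 1 1 + ofMatrix.symm x 0 1 :=
  rfl

/-- `badState (ofMatrix M) = M 1 1 + M 0 1`. [folklore] -/
@[simp]
theorem badState_ofMatrix (M : Matrix (Fin 2) (Fin 2) ℂ) :
    badState (ofMatrix M) = M 1 1 + M 0 1 := by
  rw [badState_apply, StarAlgEquiv.symm_apply_apply]

/-- The bad state kills the left ideal generated by `P = E₀₀` (matrices supported in column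
`0`). [folklore] -/
theorem badState_apply_mul_proj (x : DiscreteB2) : badState (x * proj) = 0 := by
  obtain ⟨M, rfl⟩ : ∃ M, ofMatrix M = x := ⟨ofMatrix.symm x, ofMatrix.apply_symm_apply x⟩
  rw [proj, ← map_mul, badState_ofMatrix]
  simp [Matrix.mul_apply, Fin.sum_univ_two]

/-- `ω(a⋆ P a) = 1 - i` for the bad state and `a = E₀₁ + i E₀₀`. [folklore] -/
theorem badState_star_badElement_mul_proj_mul_badElement :
    badState (star badElement * proj * badElement) = 1 - I := by
  rw [badElement, proj, ← map_star, ← map_mul, ← map_mul, badState_ofMatrix]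
  simp [Matrix.mul_apply, Fin.sum_univ_two, Matrix.conjTranspose_apply,
    Matrix.star_eq_conjTranspose]
  ring

/-- The bad state is NOT a ground state in the generator form for the inner dynamics of `P`
(`-i ω(a⋆ δ(a)) = 1 - i` is not `≥ 0`). [folklore] -/
theorem not_isGroundState_badState :
    ¬ badState.IsGroundState (projDynamics proj isStarProjection_proj) := by
  intro hω
  have h := nonneg_of_isGroundState_projDynamics isStarProjection_proj badState_apply_mul_proj hω
    badElement
  rw [badState_star_badElement_mul_proj_mul_badElement, Complex.nonneg_iff] at h
  norm_num at h

/-- The bad state IS a ground state in the analytic (`β = +∞` KMS) form for the inner dynamics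
of `P`. [folklore] -/
theorem isKMSGroundState_badState :
    badState.IsKMSGroundState (projDynamics proj isStarProjection_proj) :=
  isKMSGroundState_projDynamics isStarProjection_proj badState_apply_mul_proj

/-- **The un-ordered bridge fails on `DiscreteB2`**: for the norm-continuous automorphism group
`projDynamics proj _` there is a `State DiscreteB2` which is an analytic ground state but not a
ground state in the generator form. [folklore] -/
theorem exists_isKMSGroundState_and_not_isGroundState :
    ∃ (τ : ℝ → (DiscreteB2 ≃⋆ₐ[ℂ] DiscreteB2)) (ω : Literature.MathematicalPhysics.QuantumLattice.State DiscreteB2),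
      Literature.MathematicalPhysics.QuantumLattice.IsAutomorphismGroup τ ∧ ω.IsKMSGroundState τ ∧ ¬ ω.IsGroundState τ :=
  ⟨_, badState, isAutomorphismGroup_projDynamics proj isStarProjection_proj,
    isKMSGroundState_badState, not_isGroundState_badState⟩

-- names the `@[deprecated]` record `State.isGroundState_iff_isKMSGroundState` of `KMSStates.lean` on purpose:
-- this IS its refutation (verdict clean-up 2026-08-15); REMOVE-WHEN the record is deleted from `KMSStates.lean`
set_option linter.deprecated false in
/-- **Refutation of the mis-stated fact.** `Literature.MathematicalPhysics.QuantumLattice.State.isGroundState_iff_isKMSGroundState`, read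
as stated (for every C⋆-algebra `A`, EVERY partial order on `A` and every `τ`), is false: it
fails for `A = DiscreteB2` (Mathlib's `B(ℂ²)` with the discrete order) and the inner dynamics of
the projection `E₀₀`. The published result (Bratteli–Robinson II Prop. 5.3.19) concerns genuine,
positive states; see `Literature.MathematicalPhysics.QuantumLattice.State.isGroundState_iff_isKMSGroundState_of_starOrderedRing`.
(The refuted record is `@[deprecated]` in `KMSStates.lean` since the verdict clean-up of
2026-08-15 and kept there verbatim only because this theorem names it; hence the
`linter.deprecated` exemption on this one declaration.) [folklore] -/
theorem not_isGroundState_iff_isKMSGroundState :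
    ¬ ∀ (A : Type) [CStarAlgebra A] [PartialOrder A] (τ : ℝ → (A ≃⋆ₐ[ℂ] A)),
        Literature.MathematicalPhysics.QuantumLattice.State.isGroundState_iff_isKMSGroundState (A := A) (τ := τ) := by
  intro h
  exact not_isGroundState_badState
    ((h DiscreteB2 (projDynamics proj isStarProjection_proj)
      (isAutomorphismGroup_projDynamics proj isStarProjection_proj) badState).mpr
      isKMSGroundState_badState)

end KMSGroundStateCounterexample

end Literature.Analysis.FunctionSpaces
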